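import Summits.AtomisticToContinuum.Crystallization.Theorems.FrustratedLawDichotomyStrainedPatchHomValueT2SlopeSoundD
import Summits.AtomisticToContinuum.Crystallization.Theorems.FrustratedLawDichotomyStrainedPatchHomValueT2SlopeSoundE

/-!
# (I1) slope part F — the two per-label force enclosures IN THE BOX `(c, w)` for a `B`-family label (`…HomValueT2Track` §14b; critic row 1674 (B)
# (I1) docket item 3 `slopeT2_sound`, sixth instalment; 27623 `(H) HomFloor`, hcp half; decomp-a2c hand-1 g49)

Parts D/E with `V = U_c`, `ΔU = U − U_c`, `q = p_b + s + ξ_c`, `Δξ = ξ − ξ_c`, `top = 9` (the instantiation of `…SoundV.floorB`): for every self-adjoint `U`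
in the entry box and `ξ` in the shuffle box, the `y`-space force component of the label `b` at `(U, ξ)` differs from its centre value by at most the
`dF`-hull sum (`forceB_hull`, every label), and from its first-order model by at most half the `ddF` sum (`forceB_taylor2`, Lipschitz class).
No definitions; 0 sorry; standard axioms.  `--supports stmt-AtomisticToContinuum-27623`.
-/

noncomputable section

namespace Summit.AtomisticToContinuum.Crystallization.Theorems.FrustratedLawDichotomyStrainedPatchHomValueT2Kit

open scoped BigOperators RealInnerProductSpace
open Finset
open Literature.Analysis.ValidatedNumerics.Numerics
open Summit.AtomisticToContinuum.Crystallization.Theorems.ChargedEnergyGapNegative (E3)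
open Summit.AtomisticToContinuum.Crystallization.Theorems.FrustratedLawDichotomySchurCut (effPot w₄₅ ω₄)
open Summit.AtomisticToContinuum.Crystallization.Theorems.FrustratedLawDichotomyStrainedPatchTaylorLeaves (junctions)
open Summit.AtomisticToContinuum.Crystallization.Theorems.FrustratedLawDichotomyStrainedPatchHomSplit (latPt hexFrame hcpShift)
open Summit.AtomisticToContinuum.Crystallization.Theorems.FrustratedLawDichotomyStrainedPatchHomEntryGramHcp (shufFI)
open Summit.AtomisticToContinuum.Crystallization.Theorems.FrustratedLawDichotomyStrainedPatchHomCurvCentreKit (boxE cenMap cenShuf)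

/-- ★★ **`B`-FAMILY FORCE HULL IN THE BOX** (every label): part D `force_label_hull` instantiated. [folklore chaining] -/
theorem forceB_hull {c w : (Fin 3 × Fin 3) ⊕ Fin 3 → ℤ} (U : E3 →L[ℝ] E3) (ξ : E3) (hsa : ∀ v v' : E3, ⟪U v, v'⟫ = ⟪v, U v'⟫)
    (hc : ∀ a b : Fin 3, c (Sum.inl (a, b)) = c (Sum.inl (b, a)))
    (hbox : ∀ ab : Fin 3 × Fin 3, |(U (EuclideanSpace.single ab.2 (1 : ℝ))) ab.1 - (c (Sum.inl ab) : ℝ) / SC| ≤ (w (Sum.inl ab) : ℝ) / SC)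
    (hξ : ∀ i : Fin 3, |ξ i - (c (Sum.inr i) : ℝ) / SC| ≤ (w (Sum.inr i) : ℝ) / SC)
    {b : Fin 3 → ℤ} {Rb : DRec} (hRb : mkDRec 9 (boxE c w) (qB (shufFI c w) b) = some Rb)
    (hJ : ‖latPt (cenMap c) hexFrame b + cenMap c (hcpShift + cenShuf c)‖ ∉ junctions) (a : Fin 3) :
    |deriv (effPot w₄₅ ω₄ (3 / 400)) ‖latPt U hexFrame b + U (hcpShift + ξ)‖ / ‖latPt U hexFrame b + U (hcpShift + ξ)‖ * (latPt U hexFrame b + U (hcpShift + ξ)) a - deriv (effPot w₄₅ ω₄ (3 / 400)) ‖cenMap c (latPt (1 : E3 →L[ℝ] E3) hexFrame b + (hcpShift + cenShuf c))‖ / ‖cenMap c (latPt (1 : E3 →L[ℝ] E3) hexFrame b + (hcpShift + cenShuf c))‖ * (cenMap c (latPt (1 : E3 →L[ℝ] E3) hexFrame b + (hcpShift + cenShuf c))) a| ≤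
      ∑ k ∈ range 9, (((dF Rb a k).absHi : ℤ) : ℝ) / SC * |dispN (U - cenMap c) (ξ - cenShuf c) k| := by
  have hsym := ent_symm_disp U hsa hc
  have hJ' : ‖cenMap c (latPt (1 : E3 →L[ℝ] E3) hexFrame b + (hcpShift + cenShuf c))‖ ∉ junctions := by
    rw [map_add, ← latPt_eq_apply_one]; exact hJ
  have eU : (cenMap c + (U - cenMap c)) ((latPt (1 : E3 →L[ℝ] E3) hexFrame b + (hcpShift + cenShuf c)) + (ξ - cenShuf c)) = latPt U hexFrame b + U (hcpShift + ξ) := by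
    have ea : (latPt (1 : E3 →L[ℝ] E3) hexFrame b + (hcpShift + cenShuf c)) + (ξ - cenShuf c) = latPt (1 : E3 →L[ℝ] E3) hexFrame b + (hcpShift + ξ) := by
      abel
    rw [add_sub_cancel, ea, map_add, ← latPt_eq_apply_one]
  have h := force_label_hull (cenMap c) (U - cenMap c) (latPt (1 : E3 →L[ℝ] E3) hexFrame b + (hcpShift + cenShuf c)) (ξ - cenShuf c) hsym
    (top := 9) le_rfl (fun k hk hk9 => absurd hk9 (not_lt.2 hk)) hRb (fun t ht ab => mem_boxE_segment U hbox ht ab)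
    (fun t ht cc => mem_qB_segment ξ hξ ht b cc) hJ' a
  rw [eU] at h
  exact h

/-- ★★ **`B`-FAMILY SECOND-ORDER FORCE ENCLOSURE IN THE BOX** (Lipschitz-class label): part E `force_label_taylor2` instantiated. [folklore chaining] -/
theorem forceB_taylor2 {c w : (Fin 3 × Fin 3) ⊕ Fin 3 → ℤ} (U : E3 →L[ℝ] E3) (ξ : E3) (hsa : ∀ v v' : E3, ⟪U v, v'⟫ = ⟪v, U v'⟫)
    (hc : ∀ a b : Fin 3, c (Sum.inl (a, b)) = c (Sum.inl (b, a)))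
    (hbox : ∀ ab : Fin 3 × Fin 3, |(U (EuclideanSpace.single ab.2 (1 : ℝ))) ab.1 - (c (Sum.inl ab) : ℝ) / SC| ≤ (w (Sum.inl ab) : ℝ) / SC)
    (hξ : ∀ i : Fin 3, |ξ i - (c (Sum.inr i) : ℝ) / SC| ≤ (w (Sum.inr i) : ℝ) / SC)
    {b : Fin 3 → ℤ} {Rb : DRec} (hRb : mkDRec 9 (boxE c w) (qB (shufFI c w) b) = some Rb)
    (hJ : ‖latPt (cenMap c) hexFrame b + cenMap c (hcpShift + cenShuf c)‖ ∉ junctions) (hlip : Rb.co.lip = true) (a : Fin 3) :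
    |deriv (effPot w₄₅ ω₄ (3 / 400)) ‖latPt U hexFrame b + U (hcpShift + ξ)‖ / ‖latPt U hexFrame b + U (hcpShift + ξ)‖ * (latPt U hexFrame b + U (hcpShift + ξ)) a - deriv (effPot w₄₅ ω₄ (3 / 400)) ‖cenMap c (latPt (1 : E3 →L[ℝ] E3) hexFrame b + (hcpShift + cenShuf c))‖ / ‖cenMap c (latPt (1 : E3 →L[ℝ] E3) hexFrame b + (hcpShift + cenShuf c))‖ * (cenMap c (latPt (1 : E3 →L[ℝ] E3) hexFrame b + (hcpShift + cenShuf c))) a -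
        ∑ k ∈ range 9, ((deriv (deriv (effPot w₄₅ ω₄ (3 / 400))) ‖cenMap c (latPt (1 : E3 →L[ℝ] E3) hexFrame b + (hcpShift + cenShuf c))‖ - deriv (effPot w₄₅ ω₄ (3 / 400)) ‖cenMap c (latPt (1 : E3 →L[ℝ] E3) hexFrame b + (hcpShift + cenShuf c))‖ / ‖cenMap c (latPt (1 : E3 →L[ℝ] E3) hexFrame b + (hcpShift + cenShuf c))‖) / ‖cenMap c (latPt (1 : E3 →L[ℝ] E3) hexFrame b + (hcpShift + cenShuf c))‖ ^ 2 * (zetaN (cenMap c) (latPt (1 : E3 →L[ℝ] E3) hexFrame b + (hcpShift + cenShuf c)) k * (cenMap c (latPt (1 : E3 →L[ℝ] E3) hexFrame b + (hcpShift + cenShuf c))) a) + deriv (effPot w₄₅ ω₄ (3 / 400)) ‖cenMap c (latPt (1 : E3 →L[ℝ] E3) hexFrame b + (hcpShift + cenShuf c))‖ / ‖cenMap c (latPt (1 : E3 →L[ℝ] E3) hexFrame b + (hcpShift + cenShuf c))‖ * dyR (cenMap c) (latPt (1 : E3 →L[ℝ] E3) hexFrame b + (hcpShift + cenShuf c)) k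 a) * dispN (U - cenMap c) (ξ - cenShuf c) k| ≤
      1 / 2 * ∑ k ∈ range 9, ∑ l ∈ range 9, (((ddF Rb a k l).absHi : ℤ) : ℝ) / SC * (|dispN (U - cenMap c) (ξ - cenShuf c) k| * |dispN (U - cenMap c) (ξ - cenShuf c) l|) := by
  have hsym := ent_symm_disp U hsa hc
  have hJ' : ‖cenMap c (latPt (1 : E3 →L[ℝ] E3) hexFrame b + (hcpShift + cenShuf c))‖ ∉ junctions := by
    rw [map_add, ← latPt_eq_apply_one]; exact hJ
  have eU : (cenMap c + (U - cenMap c)) ((latPt (1 : E3 →L[ℝ] E3) hexFrame b + (hcpShift + cenShuf c)) + (ξ - cenShuf c)) = latPt U hexFrame b + U (hcpShift + ξ) := by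
    have ea : (latPt (1 : E3 →L[ℝ] E3) hexFrame b + (hcpShift + cenShuf c)) + (ξ - cenShuf c) = latPt (1 : E3 →L[ℝ] E3) hexFrame b + (hcpShift + ξ) := by
      abel
    rw [add_sub_cancel, ea, map_add, ← latPt_eq_apply_one]
  have h := force_label_taylor2 (cenMap c) (U - cenMap c) (latPt (1 : E3 →L[ℝ] E3) hexFrame b + (hcpShift + cenShuf c)) (ξ - cenShuf c) hsym
    (top := 9) le_rfl (fun k hk hk9 => absurd hk9 (not_lt.2 hk)) hRb (fun t ht ab => mem_boxE_segment U hbox ht ab)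
    (fun t ht cc => mem_qB_segment ξ hξ ht b cc) hlip a
  rw [eU] at h
  exact h

end Summit.AtomisticToContinuum.Crystallization.Theorems.FrustratedLawDichotomyStrainedPatchHomValueT2Kit
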